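import Summits.AtomisticToContinuum.Crystallization.Theorems.HullExactificationCascadeZeroDefectDensityKernel75
import Summits.AtomisticToContinuum.Crystallization.Theorems.HullExactificationCascadeZeroDefectDensitySplit
import HarnessLib

/-!
# REDUCTION of the crux `ZeroDefectDensity` (stmt-AtomisticToContinuum-12086) to ONE energetic input — line `birth`, lead c5

`zeroDefectDensity_of_softKissingOrder75`:

  soft kissing order a.e. in Lennard-Jones ground states (tolerance `1/4000`, two shells deep, gap `7/5`; = VERBATIM the
  registered stub `stub_softKissingOrder` of `Cruxes/ZeroDefectDensity/Lines/birth.lean`, ENERGETIC, open-problem-sized)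
  ⟹  `Summit.AtomisticToContinuum.Crystallization.Theses.HullExactificationCascade.ZeroDefectDensity`.

The geometric half of the line is a theorem of the tree: the one-shell effective local Hales kernel at `(1/4000, 7/5)`
(`localHalesKernel75`, `…Kernel75.lean`: soft Lemma 7, the Voronoi ownership census, the local rotation structure, the
combinatorial classification — K1 p163008, K2 p168084/p165369/p164944/p164536, K3 p168581, K4 p165337), plugged into
the strategist's split glue `zeroDefectDensity_of_softKissingOrder_of_localKernel` (`…Split.lean`, p167462: c4's cap
atoms / pins / coordinates / assembly at gap `131/100 ≤ 7/5`, scaling, density monotonicity).  One line. [folklore]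
-/

namespace Summit.AtomisticToContinuum.Crystallization.Theorems.ZeroDefectDensityBirth

/-- **THE REDUCTION (c5 form).**  Soft kissing order a.e. (tolerance `1/4000`, two shells deep, gap `7/5`) implies the crux
`HullExactificationCascade.ZeroDefectDensity`; every other step is a theorem of the tree (`localHalesKernel75` and the
split glue). [folklore] -/
theorem zeroDefectDensity_of_softKissingOrder75 : (∀ (x : (N : ℕ) → (Fin N → EuclideanSpace ℝ (Fin 3))), (∀ N, Literature.MathematicalPhysics.StatisticalMechanics.IsGroundState Literature.MathematicalPhysics.StatisticalMechanics.lennardJones (x N)) → Filter.Tendsto (fun N : ℕ => (Nat.card {i : Fin N // ¬ (∃ a : ℝ, 0 < a ∧ ∀ v ∈ Set.range (x N), dist (x N i) v ≤ 13 / 5 * a → ((∀ w ∈ Set.range (x N), w ≠ v → (1 - 1 / 4000) * a ≤ dist v w ∧ (dist v w ≤ (1 + 1 / 4000) * a ∨ 7 / 5 * a ≤ dist v w)) ∧ {w ∈ Set.range (x N) | w ≠ v ∧ dist v w ≤ (1 + 1 / 4000) * a}.ncard = 12))} : ℝ) / (N : ℝ)) Filter.atTop (nhds (0 : ℝ)))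 → Summit.AtomisticToContinuum.Crystallization.Theses.HullExactificationCascade.ZeroDefectDensity :=
  fun h => zeroDefectDensity_of_softKissingOrder_of_localKernel h localHalesKernel75

end Summit.AtomisticToContinuum.Crystallization.Theorems.ZeroDefectDensityBirth
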